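import Mathlib
import HarnessLib

/-!
# Route `PoloidalWindowDoor`, crux `PoloidalWindowRigidity` (stmt-NavierStokesRegularity-19708) — LINE 18 «leaf_uniform» v1.3: ORBIT LEMMAS for the global
# vortex lines of R15 (generic: a globally Lipschitz autonomous field on a real Banach space), FILE A of the R19 `LeafEnds` programme

Cell ns-regularity-ideate, seat ns-poloidal-K2-p2 g13 (K2 hand).  R19 `LeafEnds` (v1.3, M/L) argues with complete integral curves `γ′ = ω(γ)` of the slice
vorticity `ω(−1,·)`, which is bounded and globally Lipschitz (`…LeafUniformVortexLine.curl_slice_bounded_lipschitz`, p697506).  The purely dynamical facts it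
uses are isolated here, for any `X : E → E` Lipschitz on a real normed space (Mathlib `ODE_solution_unique_univ` / `ODE_solution_unique_of_mem_Ioo`):

* `shift_eq_of_eq` — two global integral curves that meet are time-shifts of each other: `γ₁ a = γ₂ b ⇒ γ₁ (a + σ) = γ₂ (b + σ)`;
* `localArc_eq_shift` — a LOCAL integral curve `α` on `(−δ, δ)` meeting a global one (`α s₀ = γ t`) is a piece of it: `α s = γ (t + (s − s₀))`; in particular
  its base point `α 0 = γ (t − s₀)` lies on `γ` (`localArc_base_mem_range`);
* `periodic_of_eq` — a non-injective global integral curve is periodic, and then its range is the image of one period, hence COMPACT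
  (`isCompact_range_of_periodic`, `isCompact_range_of_not_injective`).

HONEST LABEL: generic ODE bookkeeping (no NS content); support file for R19; ⟨19708⟩ OPEN; NS regularity NOT proved.
-/

noncomputable section

-- the summit and its single sub-problem share the name (CONVENTIONS §1), as in every Theorems file
set_option linter.dupNamespace false

namespace Summit.NavierStokesRegularity.NavierStokesRegularity.Theorems.PoloidalWindowDoorPoloidalWindowRigidityLeafUniformOrbits

open Set Function Filter Topology
open scoped NNReal

variable {E : Type*} [NormedAddCommGroup E] [NormedSpace ℝ E] {X : E → E} {K : ℝ≥0}

/-- **Meeting global integral curves are time-shifts of each other.** -/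
theorem shift_eq_of_eq (hX : LipschitzWith K X) {γ₁ γ₂ : ℝ → E} (h₁ : ∀ τ, HasDerivAt γ₁ (X (γ₁ τ)) τ)
    (h₂ : ∀ τ, HasDerivAt γ₂ (X (γ₂ τ)) τ) {a b : ℝ} (hab : γ₁ a = γ₂ b) (σ : ℝ) : γ₁ (a + σ) = γ₂ (b + σ) := by
  have key := ODE_solution_unique_univ (v := fun _ => X) (s := fun _ => univ) (f := fun σ => γ₁ (a + σ)) (g := fun σ => γ₂ (b + σ)) (t₀ := 0)
    (fun _ => hX.lipschitzOnWith) (fun σ => ⟨(h₁ (a + σ)).comp_const_add a σ, mem_univ _⟩)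
    (fun σ => ⟨(h₂ (b + σ)).comp_const_add b σ, mem_univ _⟩) (by simpa using hab)
  exact congrFun key σ

/-- **A local integral curve meeting a global one is a piece of it.** -/
theorem localArc_eq_shift (hX : LipschitzWith K X) {γ α : ℝ → E} (hγ : ∀ τ, HasDerivAt γ (X (γ τ)) τ) {δ : ℝ}
    (hα : ∀ s ∈ Ioo (-δ) δ, HasDerivAt α (X (α s)) s) {s₀ t : ℝ} (hs₀ : s₀ ∈ Ioo (-δ) δ) (hmeet : α s₀ = γ t) :
    ∀ s ∈ Ioo (-δ) δ, α s = γ (t + (s - s₀)) := by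
  have key := ODE_solution_unique_of_mem_Ioo (v := fun _ => X) (s := fun _ => univ) (f := α) (g := fun s => γ (t + (s - s₀))) (t₀ := s₀)
    (fun _ _ => hX.lipschitzOnWith) hs₀ (fun s hs => ⟨hα s hs, mem_univ _⟩)
    (fun s _ => ⟨by
      have h1 : HasDerivAt (fun s => t + (s - s₀)) 1 s := by
        simpa using ((hasDerivAt_id s).sub_const s₀).const_add t
      have h2 : HasDerivAt (γ ∘ fun s => t + (s - s₀)) ((1 : ℝ) • X (γ (t + (s - s₀)))) s := (hγ (t + (s - s₀))).scomp s h1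
      rw [one_smul] at h2
      exact h2, mem_univ _⟩)
    (by simpa using hmeet)
  intro s hs
  exact key hs

/-- In particular the base point of such a local arc lies on the global curve: `α 0 = γ (t − s₀)`. -/
theorem localArc_base_mem_range (hX : LipschitzWith K X) {γ α : ℝ → E} (hγ : ∀ τ, HasDerivAt γ (X (γ τ)) τ) {δ : ℝ}
    (hα : ∀ s ∈ Ioo (-δ) δ, HasDerivAt α (X (α s)) s) {s₀ t : ℝ} (hs₀ : s₀ ∈ Ioo (-δ) δ) (hmeet : α s₀ = γ t) :
    α 0 = γ (t - s₀) := by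
  have hδ : 0 < δ := by
    have := hs₀.1.trans hs₀.2
    linarith
  have h := localArc_eq_shift hX hγ hα hs₀ hmeet 0 ⟨by linarith, hδ⟩
  rw [h, zero_sub, ← sub_eq_add_neg]

/-- Every point of a local arc meeting a global curve is on the global curve. -/
theorem localArc_mem_range (hX : LipschitzWith K X) {γ α : ℝ → E} (hγ : ∀ τ, HasDerivAt γ (X (γ τ)) τ) {δ : ℝ}
    (hα : ∀ s ∈ Ioo (-δ) δ, HasDerivAt α (X (α s)) s) {s₀ t : ℝ} (hs₀ : s₀ ∈ Ioo (-δ) δ) (hmeet : α s₀ = γ t)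
    {s : ℝ} (hs : s ∈ Ioo (-δ) δ) : α s ∈ range γ :=
  ⟨t + (s - s₀), (localArc_eq_shift hX hγ hα hs₀ hmeet s hs).symm⟩

/-- **A non-injective global integral curve is periodic**: `γ a = γ b ⇒ γ (τ + (b − a)) = γ τ`. -/
theorem periodic_of_eq (hX : LipschitzWith K X) {γ : ℝ → E} (hγ : ∀ τ, HasDerivAt γ (X (γ τ)) τ) {a b : ℝ}
    (hab : γ a = γ b) : Function.Periodic γ (b - a) := by
  intro τ
  have h := shift_eq_of_eq hX hγ hγ hab.symm (τ - a)
  -- `γ (b + (τ - a)) = γ (a + (τ - a)) = γ τ`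
  have e1 : b + (τ - a) = τ + (b - a) := by ring
  have e2 : a + (τ - a) = τ := by ring
  rw [e1, e2] at h
  exact h

/-- The range of a periodic curve with positive period is the image of one period. -/
theorem range_eq_image_of_periodic {F : Type*} {γ : ℝ → F} {T : ℝ} (hT : 0 < T) (hp : Function.Periodic γ T) :
    range γ = γ '' Icc 0 T := by
  refine Subset.antisymm ?_ (image_subset_range _ _)
  rintro _ ⟨τ, rfl⟩
  obtain ⟨y, hy, hγy⟩ := hp.exists_mem_Ico₀ hT τ
  exact ⟨y, Ico_subset_Icc_self hy, hγy.symm⟩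

omit [NormedSpace ℝ E] in
/-- The range of a continuous periodic curve with positive period is compact. -/
theorem isCompact_range_of_periodic {γ : ℝ → E} (hc : Continuous γ) {T : ℝ} (hT : 0 < T) (hp : Function.Periodic γ T) :
    IsCompact (range γ) := by
  rw [range_eq_image_of_periodic hT hp]
  exact isCompact_Icc.image hc

/-- **The range of a non-injective global integral curve is compact.** -/
theorem isCompact_range_of_not_injective (hX : LipschitzWith K X) {γ : ℝ → E} (hγ : ∀ τ, HasDerivAt γ (X (γ τ)) τ)
    (hni : ¬ Function.Injective γ) : IsCompact (range γ) := by
  have hc : Continuous γ := continuous_iff_continuousAt.2 fun τ => (hγ τ).continuousAt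
  obtain ⟨a, b, hab, hne⟩ : ∃ a b, γ a = γ b ∧ a ≠ b := by
    unfold Function.Injective at hni
    push Not at hni
    exact hni
  rcases lt_or_gt_of_ne hne with h | h
  · exact isCompact_range_of_periodic hc (sub_pos.2 h) (periodic_of_eq hX hγ hab)
  · exact isCompact_range_of_periodic hc (sub_pos.2 h) (periodic_of_eq hX hγ hab.symm)

end Summit.NavierStokesRegularity.NavierStokesRegularity.Theorems.PoloidalWindowDoorPoloidalWindowRigidityLeafUniformOrbits

end
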